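import Summits.QuantumFields.YangMills.Theorems.DiagonalMirrorRPRTwoShiftProbesAt
import Summits.QuantumFields.YangMills.Theorems.DiagonalMirrorRPRTransferModelLetters
import Summits.QuantumFields.YangMills.Theorems.PencilRigidityWeakCouplingHypercubicLimitRPDiagRPOfTwistLetters
import Summits.QuantumFields.YangMills.Theorems.WeakCouplingHypercubicLimitRP.Negative.OddTorusSwapPairingLiminf
import HarnessLib

/-!
# Crux `WeakCouplingHypercubicLimitRP` (stmt-QuantumFields-27398), door B: the COMPOSITION FILE —
# D1′-binders + letters + `twoShiftProbesAt` ⇒ `OddTwistGap` ⇒ D1′ (and D1), by name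

Helper file (`--supports stmt-QuantumFields-27398 --as helper`) of hand `hand-10604-wilsonDiagModel-3` g0, docket director-ym g24
**O4 WORD 49 (3) / WORD 50 (4)** («the one-file by-name composition `D1′-binders + letters K1∕K2∕R2♭ + SlowCoupled + twoShiftProbesAt ⇒
OddTwistGap ⇒ …` via ✓`oddTwistGap_of_rpSpectral_of_twoShiftLetters`»).  Everything here is a one-line composition of LANDED theorems:

* §1 on the scheme `sch` (model of record `wilsonDiagonalTransferModel r sch hβ`, `β_k ≥ 0`):
  ★ `oddTwistGap_transferModel_of_rpSpectral` — AXIS letter `RPSpectral r sch Δ C` (`Δ > 0`, `C ≥ 0`) + item (ii)'s identities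
  `I : TwoShiftIdentities r sch hβ P` for a pinned probe `P` + the coupling letter `SlowCoupled I` + K1 `CoarseGap 𝔭 M ∧ JunkVisible 𝔭 M`
  (`M_k → ∞`) + K2 `SlowestVisible 𝔭 (Δ/32)`, `𝔭 := twoShiftProbesAt I C hC hc` ⇒ R1 `OddTwistGap (wilsonDiagonalTransferModel r sch hβ)`
  (✓`oddTwistGap_of_rpSpectral_of_twoShiftLetters` on ✓`twoShiftProbesAt_pinnedTo`);
  `oddTorusSwapPairingLiminf_transferModel_of_rpSpectral` (+ R2 `DiagLukewarm` + `Growth` ⇒ `OddTorusSwapPairingLiminf r sch`,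
  ✓`oddTorusSwapPairingLiminf_of_transferModel`) and `…_tepid` (R2♭ `DiagTepid`, ✓`…_of_transferModel_tepid`);
* §2 along a sub-scheme `φ` (the letters live on the model of the FULL scheme and restrict, ✓`OddTwistGap.restrict` / ✓`DiagTepid.restrict` /
  ✓`DiagLukewarm.restrict`; `Growth (subseq sch φ hφ)` from D1′'s own binders by ✓`growth_subseq_of_polyRenorm_of_ufbPlanes`):
  `oddTorusSwapPairingLiminf_subseq_transferModel_of_rpSpectral_tepid` / `…_of_rpSpectral` and the D1 readings
  `diagonalFrameRP_transferModel_of_rpSpectral(_tepid)` (`DiagonalFrameRP (planeSum T)` via ✓`diagRPOfPlaneLimits_of_twistLetters` /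
  ✓`diagRPOfPlaneLimits_of_swapPairingLiminf`);
* §3 ★ `stub_oddTorusSwapPairingLiminf_of_doorB` — D1′ `stub_oddTorusSwapPairingLiminf` (ρ1 v2, `Cruxes/…/Lines/Sketch.lean :1650`)'s EXACT
  binder list, followed by: `(hβ : ∀ k, 0 ≤ sch.β k)` (the model of record is defined under it for ALL `k`; weak coupling gives it only
  eventually — an honest extra binder, not hidden), explicit `Δ C` with `0 < Δ`, `0 ≤ C`, `RPSpectral r sch Δ C` (the binder's `∃ Δ C` cannot
  name the constants the probe letters refer to, so it is carried unused and the located form is taken), the pinned probe `P`, (ii)'s `I`,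
  `SlowCoupled I`, `M → ∞`, K1, K2(`Δ/32`), R2♭ `DiagTepid` ⇒ D1′'s conclusion `OddTorusSwapPairingLiminf r (subseq sch φ hφ)` BY NAME;
  `stub_diagRPOfPlaneLimits_of_doorB` the same list ⇒ D1's conclusion `DiagonalFrameRP (planeSum T)`;
* §4 the WEAKER consumed form (parallel to door C's ✓`stub_oddTorusSwapPairingLiminf_of_seamInfluenceDecay`): ★ `stub_oddTorusSwapPairingLiminf_of_doorB_subseq` / `stub_diagRPOfPlaneLimits_of_doorB_subseq` — the probe, (ii)'s `I`, the
  coupling letter, K1, K2 and R2♭ read ONLY ALONG THE WITNESS SUB-SCHEME `subseq sch φ hφ` (its own model of record), `RPSpectral` transported by the LANDED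
  ✓`rpSpectral_subseq` (`…WeakCouplingHypercubicLimitRP.Negative.OddTorusSwapPairingLiminf`, cdisprove; imported, not restated).

SECTOR CAVEAT (critic idea-crit-9 g13 customs 18:39Z, named risk R-sector, price p-V1 — recorded, not repaired): the slowest ratio
`r_k = slowRatio (wilsonDiagonalTransferModel r sch hβ) k`, hence K1 `CoarseGap`, K2 `SlowestVisible` and the coupling letter `SlowCoupled I`, are
read on the FULL spectrum of the slice transfer operator `slicePkgAt r sch hβ k` (all sectors, both signs), NOT on the cyclic subspace generated
from the vacuum by the probe's local gauge-invariant observables.  If the slowest sub-top modulus lives in a sector orthogonal to every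
contractible local probe (centre-charged torelon / winding-flux states of the finite torus, a `U`-odd or charge sector), then `SlowCoupled I` is
FALSE for every pinned `P` and this road dies honestly (no contradiction, no spurious success; the same issue sits inside K1, «ALL sectors»).
The sector-relative variant — `slowRatio` restricted to the cyclic subspace of local probes, with §1 of the extraction re-read there — is the
NAMED, UN-COMMISSIONED repair; no new letter is introduced here to paper over R-sector.

HONEST FRAMING: soft composition; the open content of door B is exactly the hypotheses displayed — the AXIS letter `RPSpectral` (wall), item
(ii)'s identities for Wilson's slices (engineering, hand-2 g3), the coupling letter `SlowCoupled` (W-45-vis), K1 `CoarseGap ∧ JunkVisible`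
(W-45-coarse), K2 `SlowestVisible` (W-45-vis), R2♭ `DiagTepid` / R2 `DiagLukewarm` — none of them is proved here or anywhere in the tree; this
file does NOT close D1′; D1′, the crux ⟨27398⟩, its heart S6i and the summit are OPEN; the Yang–Mills mass gap is NOT proved here or anywhere in
the tree.  No definition, no instance, no notation, `autoImplicit false`.

References: Fröhlich–Israel–Lieb–Simon, CMP 62 (1978) Thm 2.1; Osterwalder–Seiler, Ann. Phys. 110 (1978) §2–3.
-/

set_option autoImplicit false

noncomputable section

open scoped SchwartzMap
open MeasureTheory Filter Topology
open Literature.MathematicalPhysics.QuantumLattice Literature.MathematicalPhysics.AQFT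
  Literature.MathematicalPhysics.QuantumFieldTheory
open Summit.QuantumFields.YangMills.Cruxes.HypercubicLimit.CouplingResponse
open Summit.QuantumFields.YangMills.Cruxes.DiagonalMirrorRPR.ParityBridgeColdTraces (E4 DiagonalFrameRP)
open Summit.QuantumFields.YangMills.Cruxes.DiagonalMirrorRPR.SignTwistedDiagonalTrace
open Summit.QuantumFields.YangMills.Cruxes.DiagonalMirrorRPR.SignTwistedDiagonalTrace.WilsonDiagonal
open Summit.QuantumFields.YangMills.Theorems.WeakCouplingHypercubicLimit.TraceNormColdPressure
  (diagRPOfPlaneLimits_of_twistLetters diagRPOfPlaneLimits_of_swapPairingLiminf)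
open Summit.QuantumFields.YangMills.Theorems.WeakCouplingHypercubicLimitRP.Negative.OddTorusSwapPairingLiminf (rpSpectral_subseq)

namespace Summit.QuantumFields.YangMills.Cruxes.DiagonalMirrorRPR.SpectralTransfer

variable {G : Type} [Group G] [TopologicalSpace G] [IsTopologicalGroup G] [CompactSpace G]
  [MeasurableSpace G] [BorelSpace G] {r : LatticeRep G} {sch : SpeciesScheme (YMSpecies G)}
  {hβ : ∀ k, 0 ≤ sch.β k} {P : PinnedProbe sch}

/-! ## §1 On the scheme: R1 and the line's lattice statement from the letters -/

/-- ★ **R1 on the model of record from the AXIS letter and the probe letters**: `RPSpectral r sch Δ C` (`Δ > 0`, `C ≥ 0`), item (ii)'s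
identities `I` for a pinned probe `P`, the coupling letter `SlowCoupled I`, K1 `CoarseGap ∧ JunkVisible` (`M_k → ∞`) and K2 `SlowestVisible (Δ/32)`
on the instance `twoShiftProbesAt I C hC hc` ⇒ `OddTwistGap (wilsonDiagonalTransferModel r sch hβ)` (✓`oddTwistGap_of_rpSpectral_of_twoShiftLetters`
on ✓`twoShiftProbesAt_pinnedTo`). [cite: FrohlichIsraelLiebSimon1978, Thm. 2.1] -/
theorem oddTwistGap_transferModel_of_rpSpectral (I : TwoShiftIdentities r sch hβ P) {Δ C : ℝ} {M : ℕ → ℝ}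
    (hΔ : 0 < Δ) (hC : 0 ≤ C) (hc : SlowCoupled I) (hRP : RPSpectral r sch Δ C) (hM : Tendsto M atTop atTop)
    (hgap : CoarseGap (twoShiftProbesAt I C hC hc) M) (hjunk : JunkVisible (twoShiftProbesAt I C hC hc) M)
    (hvis : SlowestVisible (twoShiftProbesAt I C hC hc) (Δ / 32)) :
    OddTwistGap (wilsonDiagonalTransferModel r sch hβ) :=
  oddTwistGap_of_rpSpectral_of_twoShiftLetters (twoShiftProbesAt I C hC hc) P (twoShiftProbesAt_pinnedTo I C hC hc) hΔ hC
    (Eventually.of_forall hβ) hRP hM hgap hjunk hvis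

/-- **Door B to the line's lattice statement on the scheme**: the above with R2 `DiagLukewarm` and the growth clause give
`OddTorusSwapPairingLiminf r sch` (✓`oddTorusSwapPairingLiminf_of_transferModel`). [cite: FrohlichIsraelLiebSimon1978, Thm. 2.1] -/
theorem oddTorusSwapPairingLiminf_transferModel_of_rpSpectral (I : TwoShiftIdentities r sch hβ P) {Δ C : ℝ} {M : ℕ → ℝ}
    (hΔ : 0 < Δ) (hC : 0 ≤ C) (hc : SlowCoupled I) (hRP : RPSpectral r sch Δ C) (hM : Tendsto M atTop atTop)
    (hgap : CoarseGap (twoShiftProbesAt I C hC hc) M) (hjunk : JunkVisible (twoShiftProbesAt I C hC hc) M)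
    (hvis : SlowestVisible (twoShiftProbesAt I C hC hc) (Δ / 32))
    (hR2 : DiagLukewarm (wilsonDiagonalTransferModel r sch hβ)) (hG : Growth r sch) :
    OddTorusSwapPairingLiminf r sch :=
  oddTorusSwapPairingLiminf_of_transferModel r sch hβ
    (oddTwistGap_transferModel_of_rpSpectral I hΔ hC hc hRP hM hgap hjunk hvis) hR2 hG

/-- The same with R2♭ `DiagTepid` (✓`oddTorusSwapPairingLiminf_of_transferModel_tepid`). [cite: FrohlichIsraelLiebSimon1978, Thm. 2.1] -/
theorem oddTorusSwapPairingLiminf_transferModel_of_rpSpectral_tepid (I : TwoShiftIdentities r sch hβ P) {Δ C : ℝ} {M : ℕ → ℝ}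
    (hΔ : 0 < Δ) (hC : 0 ≤ C) (hc : SlowCoupled I) (hRP : RPSpectral r sch Δ C) (hM : Tendsto M atTop atTop)
    (hgap : CoarseGap (twoShiftProbesAt I C hC hc) M) (hjunk : JunkVisible (twoShiftProbesAt I C hC hc) M)
    (hvis : SlowestVisible (twoShiftProbesAt I C hC hc) (Δ / 32))
    (hR2 : DiagTepid (wilsonDiagonalTransferModel r sch hβ)) (hG : Growth r sch) :
    OddTorusSwapPairingLiminf r sch :=
  oddTorusSwapPairingLiminf_of_transferModel_tepid r sch hβ
    (oddTwistGap_transferModel_of_rpSpectral I hΔ hC hc hRP hM hgap hjunk hvis) hR2 hG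

/-! ## §2 Along a sub-scheme: D1′'s and D1's conclusions from the letters on the full scheme's model -/

/-- **D1′'s conclusion along `φ` (R2♭ edition)**: the §1 letters on the model of record of the FULL scheme + D1's clauses `PolyRenorm`,
`UniformFunctionalBoundPlanes`, `PolyVolume` ⇒ `OddTorusSwapPairingLiminf r (subseq sch φ hφ)`
(✓`oddTorusSwapPairingLiminf_subseq_of_transferModel_tepid`: restriction of the letters + `Growth` of the sub-scheme). [cite: FrohlichIsraelLiebSimon1978, Thm. 2.1] -/
theorem oddTorusSwapPairingLiminf_subseq_transferModel_of_rpSpectral_tepid (I : TwoShiftIdentities r sch hβ P) {Δ C : ℝ}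
    {M : ℕ → ℝ} (φ : ℕ → ℕ) (hφ : StrictMono φ)
    (hΔ : 0 < Δ) (hC : 0 ≤ C) (hc : SlowCoupled I) (hRP : RPSpectral r sch Δ C) (hM : Tendsto M atTop atTop)
    (hgap : CoarseGap (twoShiftProbesAt I C hC hc) M) (hjunk : JunkVisible (twoShiftProbesAt I C hC hc) M)
    (hvis : SlowestVisible (twoShiftProbesAt I C hC hc) (Δ / 32))
    (hR2 : DiagTepid (wilsonDiagonalTransferModel r sch hβ))
    (hcR : PolyRenorm r sch) (hU : UniformFunctionalBoundPlanes r sch) (hV : PolyVolume sch) :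
    OddTorusSwapPairingLiminf r (subseq sch φ hφ) :=
  oddTorusSwapPairingLiminf_subseq_of_transferModel_tepid r sch hβ φ hφ
    (oddTwistGap_transferModel_of_rpSpectral I hΔ hC hc hRP hM hgap hjunk hvis) hR2 hcR hU hV

/-- **D1′'s conclusion along `φ` (R2 edition)**: as above with R2 `DiagLukewarm` (`core_of` on the restricted model). [cite: FrohlichIsraelLiebSimon1978, Thm. 2.1] -/
theorem oddTorusSwapPairingLiminf_subseq_transferModel_of_rpSpectral (I : TwoShiftIdentities r sch hβ P) {Δ C : ℝ}
    {M : ℕ → ℝ} (φ : ℕ → ℕ) (hφ : StrictMono φ)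
    (hΔ : 0 < Δ) (hC : 0 ≤ C) (hc : SlowCoupled I) (hRP : RPSpectral r sch Δ C) (hM : Tendsto M atTop atTop)
    (hgap : CoarseGap (twoShiftProbesAt I C hC hc) M) (hjunk : JunkVisible (twoShiftProbesAt I C hC hc) M)
    (hvis : SlowestVisible (twoShiftProbesAt I C hC hc) (Δ / 32))
    (hR2 : DiagLukewarm (wilsonDiagonalTransferModel r sch hβ))
    (hcR : PolyRenorm r sch) (hU : UniformFunctionalBoundPlanes r sch) (hV : PolyVolume sch) :
    OddTorusSwapPairingLiminf r (subseq sch φ hφ) :=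
  core_of ((wilsonDiagonalTransferModel r sch hβ).restrict φ hφ)
    ((oddTwistGap_transferModel_of_rpSpectral I hΔ hC hc hRP hM hgap hjunk hvis).restrict φ hφ) (hR2.restrict φ hφ)
    (growth_subseq_of_polyRenorm_of_ufbPlanes r sch hcR hU hV φ hφ)

/-- **D1's conclusion along `φ` (R2 edition)**: the letters + `PlaneLimits r sch φ T` ⇒ `DiagonalFrameRP (planeSum T)`
(✓`diagRPOfPlaneLimits_of_twistLetters` on `TwistLetters r (subseq sch φ hφ)` witnessed by the restricted model of record). [cite: FrohlichIsraelLiebSimon1978, Thm. 2.1] -/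
theorem diagonalFrameRP_transferModel_of_rpSpectral (I : TwoShiftIdentities r sch hβ P) {Δ C : ℝ} {M : ℕ → ℝ}
    (φ : ℕ → ℕ) (hφ : StrictMono φ)
    (T : (n : ℕ) → (Fin n → Plane) → (𝓢((Fin n → EuclideanSpace ℝ (Fin 4)), ℂ) →L[ℂ] ℂ))
    (hΔ : 0 < Δ) (hC : 0 ≤ C) (hc : SlowCoupled I) (hRP : RPSpectral r sch Δ C) (hM : Tendsto M atTop atTop)
    (hgap : CoarseGap (twoShiftProbesAt I C hC hc) M) (hjunk : JunkVisible (twoShiftProbesAt I C hC hc) M)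
    (hvis : SlowestVisible (twoShiftProbesAt I C hC hc) (Δ / 32))
    (hR2 : DiagLukewarm (wilsonDiagonalTransferModel r sch hβ))
    (hcR : PolyRenorm r sch) (hU : UniformFunctionalBoundPlanes r sch) (hV : PolyVolume sch) (hPL : PlaneLimits r sch φ T) :
    DiagonalFrameRP (planeSum T) :=
  diagRPOfPlaneLimits_of_twistLetters r sch φ hφ T hV hcR hU hPL
    ⟨(wilsonDiagonalTransferModel r sch hβ).restrict φ hφ,
      (oddTwistGap_transferModel_of_rpSpectral I hΔ hC hc hRP hM hgap hjunk hvis).restrict φ hφ, hR2.restrict φ hφ⟩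

/-- **D1's conclusion along `φ` (R2♭ edition)**: via D1′'s conclusion (`…_tepid`) and the LANDED transfer
✓`diagRPOfPlaneLimits_of_swapPairingLiminf` (p827255). [cite: FrohlichIsraelLiebSimon1978, Thm. 2.1] -/
theorem diagonalFrameRP_transferModel_of_rpSpectral_tepid (I : TwoShiftIdentities r sch hβ P) {Δ C : ℝ} {M : ℕ → ℝ}
    (φ : ℕ → ℕ) (hφ : StrictMono φ)
    (T : (n : ℕ) → (Fin n → Plane) → (𝓢((Fin n → EuclideanSpace ℝ (Fin 4)), ℂ) →L[ℂ] ℂ))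
    (hΔ : 0 < Δ) (hC : 0 ≤ C) (hc : SlowCoupled I) (hRP : RPSpectral r sch Δ C) (hM : Tendsto M atTop atTop)
    (hgap : CoarseGap (twoShiftProbesAt I C hC hc) M) (hjunk : JunkVisible (twoShiftProbesAt I C hC hc) M)
    (hvis : SlowestVisible (twoShiftProbesAt I C hC hc) (Δ / 32))
    (hR2 : DiagTepid (wilsonDiagonalTransferModel r sch hβ))
    (hcR : PolyRenorm r sch) (hU : UniformFunctionalBoundPlanes r sch) (hV : PolyVolume sch) (hPL : PlaneLimits r sch φ T) :
    DiagonalFrameRP (planeSum T) :=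
  diagRPOfPlaneLimits_of_swapPairingLiminf G r sch φ hφ T hU hPL
    ((oddTorusSwapPairingLiminf_iff r _).1
      (oddTorusSwapPairingLiminf_subseq_transferModel_of_rpSpectral_tepid I φ hφ hΔ hC hc hRP hM hgap hjunk hvis hR2 hcR hU hV))

/-! ## §3 D1′ and D1 modulo the door-B letters: the registered binder lists, by name -/

/-- ★ **D1′ (`stub_oddTorusSwapPairingLiminf` of `Cruxes/WeakCouplingHypercubicLimitRP/Lines/Sketch.lean`, ρ1 v2) modulo the door-B
letters** — D1′'s EXACT binder list, followed by: `β_k ≥ 0` for all `k` (the model of record is defined under it), the located AXIS letter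
`RPSpectral r sch Δ C` with `0 < Δ`, `0 ≤ C` (the binder's `∃ Δ C` is carried unused: the probe letters name the constants), a pinned probe `P`,
item (ii)'s identities `I`, the coupling letter `SlowCoupled I`, `M_k → ∞`, K1 `CoarseGap ∧ JunkVisible`, K2 `SlowestVisible (Δ/32)` on
`twoShiftProbesAt I C hC hc`, and R2♭ `DiagTepid (wilsonDiagonalTransferModel r sch hβ)` — implies D1′'s conclusion BY NAME.  It does NOT
close D1′: every letter displayed is open. [cite: FrohlichIsraelLiebSimon1978, Thm. 2.1] -/
theorem stub_oddTorusSwapPairingLiminf_of_doorB :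
    ∀ (G : Type) [Group G] [TopologicalSpace G] [IsTopologicalGroup G] [CompactSpace G]
      [MeasurableSpace G] [BorelSpace G] (r : LatticeRep G) (sch : SpeciesScheme (YMSpecies G))
      (φ : ℕ → ℕ) (hφ : StrictMono φ)
      (T : (n : ℕ) → (Fin n → Plane) → (𝓢((Fin n → EuclideanSpace ℝ (Fin 4)), ℂ) →L[ℂ] ℂ)),
      sch.HasWeakCouplingLimit → PolyVolume sch → PolyRenorm r sch → UniformFunctionalBoundPlanes r sch →
        (∃ Δ C : ℝ, 0 < Δ ∧ RPSpectral r sch Δ C) → PlaneLimits r sch φ T →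
        ∀ (hβ : ∀ k, 0 ≤ sch.β k) (Δ C : ℝ) (_ : 0 < Δ) (hC : 0 ≤ C), RPSpectral r sch Δ C →
        ∀ (P : PinnedProbe sch) (I : TwoShiftIdentities r sch hβ P) (hc : SlowCoupled I) (M : ℕ → ℝ),
          Tendsto M atTop atTop → CoarseGap (twoShiftProbesAt I C hC hc) M → JunkVisible (twoShiftProbesAt I C hC hc) M →
          SlowestVisible (twoShiftProbesAt I C hC hc) (Δ / 32) → DiagTepid (wilsonDiagonalTransferModel r sch hβ) →
            OddTorusSwapPairingLiminf r (subseq sch φ hφ) := by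
  intro G _ _ _ _ _ _ r sch φ hφ T _ hV hcR hU _ _ hβ Δ C hΔ hC hRP P I hc M hM hgap hjunk hvis hR2
  exact oddTorusSwapPairingLiminf_subseq_transferModel_of_rpSpectral_tepid I φ hφ hΔ hC hc hRP hM hgap hjunk hvis hR2 hcR hU hV

/-- **D1 (`stub_diagRPOfPlaneLimits`, v1 :1618; = `diagRPOfPlaneLimits_of_stubs` of ρ1 v2) modulo the door-B letters** — the same list
implies D1's conclusion `DiagonalFrameRP (planeSum T)` BY NAME (here `PlaneLimits` and `UniformFunctionalBoundPlanes` are used, by the landed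
transfer ✓`diagRPOfPlaneLimits_of_swapPairingLiminf`). [cite: FrohlichIsraelLiebSimon1978, Thm. 2.1] -/
theorem stub_diagRPOfPlaneLimits_of_doorB :
    ∀ (G : Type) [Group G] [TopologicalSpace G] [IsTopologicalGroup G] [CompactSpace G]
      [MeasurableSpace G] [BorelSpace G] (r : LatticeRep G) (sch : SpeciesScheme (YMSpecies G))
      (φ : ℕ → ℕ) (hφ : StrictMono φ)
      (T : (n : ℕ) → (Fin n → Plane) → (𝓢((Fin n → EuclideanSpace ℝ (Fin 4)), ℂ) →L[ℂ] ℂ)),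
      sch.HasWeakCouplingLimit → PolyVolume sch → PolyRenorm r sch → UniformFunctionalBoundPlanes r sch →
        (∃ Δ C : ℝ, 0 < Δ ∧ RPSpectral r sch Δ C) → PlaneLimits r sch φ T →
        ∀ (hβ : ∀ k, 0 ≤ sch.β k) (Δ C : ℝ) (_ : 0 < Δ) (hC : 0 ≤ C), RPSpectral r sch Δ C →
        ∀ (P : PinnedProbe sch) (I : TwoShiftIdentities r sch hβ P) (hc : SlowCoupled I) (M : ℕ → ℝ),
          Tendsto M atTop atTop → CoarseGap (twoShiftProbesAt I C hC hc) M → JunkVisible (twoShiftProbesAt I C hC hc) M →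
          SlowestVisible (twoShiftProbesAt I C hC hc) (Δ / 32) → DiagTepid (wilsonDiagonalTransferModel r sch hβ) →
            DiagonalFrameRP (planeSum T) := by
  intro G _ _ _ _ _ _ r sch φ hφ T _ hV hcR hU _ hPL hβ Δ C hΔ hC hRP P I hc M hM hgap hjunk hvis hR2
  exact diagonalFrameRP_transferModel_of_rpSpectral_tepid I φ hφ T hΔ hC hc hRP hM hgap hjunk hvis hR2 hcR hU hV hPL

/-! ## §4 The weaker consumed form: letters only ALONG the witness sub-scheme -/

/-- ★ **D1′ modulo the door-B letters read ONLY ALONG THE WITNESS SUB-SCHEME** (the weaker consumed form, parallel to door C's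
✓`stub_oddTorusSwapPairingLiminf_of_seamInfluenceDecay`): D1′'s EXACT binder list, followed by: `β ≥ 0` along `φ`, the located AXIS letter
`RPSpectral r sch Δ C` (`0 < Δ`, `0 ≤ C`; transported to the sub-scheme by ✓`rpSpectral_subseq`), a pinned probe `P` of the SUB-scheme, item (ii)'s
identities `I` there, `SlowCoupled I`, `M → ∞`, K1, K2(`Δ/32`) on `twoShiftProbesAt I C hC hc`, and R2♭ `DiagTepid` on the sub-scheme's model of
record `wilsonDiagonalTransferModel r (subseq sch φ hφ) hβ` ⇒ D1′'s conclusion BY NAME (`Growth` of the sub-scheme from D1′'s own binders,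
✓`growth_subseq_of_polyRenorm_of_ufbPlanes`).  Does NOT close D1′. [cite: FrohlichIsraelLiebSimon1978, Thm. 2.1] -/
theorem stub_oddTorusSwapPairingLiminf_of_doorB_subseq :
    ∀ (G : Type) [Group G] [TopologicalSpace G] [IsTopologicalGroup G] [CompactSpace G]
      [MeasurableSpace G] [BorelSpace G] (r : LatticeRep G) (sch : SpeciesScheme (YMSpecies G))
      (φ : ℕ → ℕ) (hφ : StrictMono φ)
      (T : (n : ℕ) → (Fin n → Plane) → (𝓢((Fin n → EuclideanSpace ℝ (Fin 4)), ℂ) →L[ℂ] ℂ)),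
      sch.HasWeakCouplingLimit → PolyVolume sch → PolyRenorm r sch → UniformFunctionalBoundPlanes r sch →
        (∃ Δ C : ℝ, 0 < Δ ∧ RPSpectral r sch Δ C) → PlaneLimits r sch φ T →
        ∀ (hβ : ∀ k, 0 ≤ (subseq sch φ hφ).β k) (Δ C : ℝ) (_ : 0 < Δ) (hC : 0 ≤ C), RPSpectral r sch Δ C →
        ∀ (P : PinnedProbe (subseq sch φ hφ)) (I : TwoShiftIdentities r (subseq sch φ hφ) hβ P) (hc : SlowCoupled I) (M : ℕ → ℝ),
          Tendsto M atTop atTop → CoarseGap (twoShiftProbesAt I C hC hc) M → JunkVisible (twoShiftProbesAt I C hC hc) M →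
          SlowestVisible (twoShiftProbesAt I C hC hc) (Δ / 32) → DiagTepid (wilsonDiagonalTransferModel r (subseq sch φ hφ) hβ) →
            OddTorusSwapPairingLiminf r (subseq sch φ hφ) := by
  intro G _ _ _ _ _ _ r sch φ hφ T _ hV hcR hU _ _ hβ Δ C hΔ hC hRP P I hc M hM hgap hjunk hvis hR2
  exact oddTorusSwapPairingLiminf_transferModel_of_rpSpectral_tepid I hΔ hC hc (rpSpectral_subseq r sch φ hφ hRP) hM hgap hjunk
    hvis hR2 (growth_subseq_of_polyRenorm_of_ufbPlanes r sch hcR hU hV φ hφ)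

/-- **D1 modulo the door-B letters along the witness sub-scheme**: the same list ⇒ `DiagonalFrameRP (planeSum T)`
(✓`diagRPOfPlaneLimits_of_swapPairingLiminf`). [cite: FrohlichIsraelLiebSimon1978, Thm. 2.1] -/
theorem stub_diagRPOfPlaneLimits_of_doorB_subseq :
    ∀ (G : Type) [Group G] [TopologicalSpace G] [IsTopologicalGroup G] [CompactSpace G]
      [MeasurableSpace G] [BorelSpace G] (r : LatticeRep G) (sch : SpeciesScheme (YMSpecies G))
      (φ : ℕ → ℕ) (hφ : StrictMono φ)
      (T : (n : ℕ) → (Fin n → Plane) → (𝓢((Fin n → EuclideanSpace ℝ (Fin 4)), ℂ) →L[ℂ] ℂ)),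
      sch.HasWeakCouplingLimit → PolyVolume sch → PolyRenorm r sch → UniformFunctionalBoundPlanes r sch →
        (∃ Δ C : ℝ, 0 < Δ ∧ RPSpectral r sch Δ C) → PlaneLimits r sch φ T →
        ∀ (hβ : ∀ k, 0 ≤ (subseq sch φ hφ).β k) (Δ C : ℝ) (_ : 0 < Δ) (hC : 0 ≤ C), RPSpectral r sch Δ C →
        ∀ (P : PinnedProbe (subseq sch φ hφ)) (I : TwoShiftIdentities r (subseq sch φ hφ) hβ P) (hc : SlowCoupled I) (M : ℕ → ℝ),
          Tendsto M atTop atTop → CoarseGap (twoShiftProbesAt I C hC hc) M → JunkVisible (twoShiftProbesAt I C hC hc) M →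
          SlowestVisible (twoShiftProbesAt I C hC hc) (Δ / 32) → DiagTepid (wilsonDiagonalTransferModel r (subseq sch φ hφ) hβ) →
            DiagonalFrameRP (planeSum T) := by
  intro G _ _ _ _ _ _ r sch φ hφ T _ hV hcR hU _ hPL hβ Δ C hΔ hC hRP P I hc M hM hgap hjunk hvis hR2
  exact diagRPOfPlaneLimits_of_swapPairingLiminf G r sch φ hφ T hU hPL
    ((oddTorusSwapPairingLiminf_iff r _).1
      (oddTorusSwapPairingLiminf_transferModel_of_rpSpectral_tepid I hΔ hC hc (rpSpectral_subseq r sch φ hφ hRP) hM hgap hjunk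
        hvis hR2 (growth_subseq_of_polyRenorm_of_ufbPlanes r sch hcR hU hV φ hφ)))

end Summit.QuantumFields.YangMills.Cruxes.DiagonalMirrorRPR.SpectralTransfer

end
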